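import Summits.CriticalPhenomena.PercolationContinuityZ3.Theorems.FK.Transplant.KNFreeSeedsLift
import Summits.CriticalPhenomena.PercolationContinuityZ3.Theorems.FK.Transplant.FreeBoundaryHypotheses
import Summits.CriticalPhenomena.PercolationContinuityZ3.Theorems.FK.ConditionalEnergyToolkit
import HarnessLib

/-!
# FRONTIER TRANSPLANT, research line R-TP (row `h_tgt`, OPEN-2 by lead ruling L7), part 6: the finite-energy hypotheses of the
# measure-generic KN Steps II–III DISCHARGED for the transplant's law of record `fkLaw Λ W q`

Support file (`--supports stmt-CriticalPhenomena-4575`, helper) of the FRONTIER TRANSPLANT sub-cell (`fk-continuity/transplant/`, seat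
`prim-bschramm-fkt-p1`); builds on p205010 (kernel theorem, internal audit signed; external expert review pending).  No definitions, no
named facts, no sorries; standard axioms.

HONEST FRAMING (page 1, cell rule; lead ruling L7).  The transplant's theorem of record `ufsc0_of_freeBoundaryHypothesis_r0` is CONDITIONAL on
FH (free-box hittability; open at the same `p` for every `q > 1`; GRC Conj. (5.103)-calibre via K1, barrier note
`Literature.Barriers.CriticalPhenomena.SamePFreeBoundaryCriteria`) AND on TP_FK (`KNFreeTargetHittable`: Kozma–Nitzan's target Lemma 10 for
finite-volume FK laws; a theorem at `q = 1`, no derivation known for `q > 1` — design note `transplant/prim-bschramm-fkt-p1/FT03-DESIGN.md`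
§3/§7: the missing step is the first-relay decoupling of KN p. 21).  The transplant is a typed reduction, not a proof of FK continuity.
THIS FILE is unconditional and is the part of KN Lemma 10 that IS kernel-checked for FK: its Steps II–III (parts 1, 2, 5 of this seat) hold
under the law of record, because that law satisfies the three finite-energy hypotheses — proved here.

CONTENT (namespace `…Theorems.FK.KNFree`; `fkLaw Λ W q = (rcMeasureW (W ∘ Sym2.map Subtype.val) q ∅).map (liftEdges Λ)`, FT-01):
* `mem_range_sym2Map_of_forall_mem` — a pair with both endpoints in `Λ` is a lifted pair;
* `forall_mem_of_finSupp` — under `FinSupp W Λ`, a pair of nonzero weight has both endpoints in `Λ`;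
* **`ins_tolerance_fkLaw`** — `π^{|F|} · (fkLaw Λ W q){ω | ω ∪ F ∈ A} ≤ (fkLaw Λ W q)(A)`, `π = p/(p + q(1-p))`, for `q ≥ 1`, every finite `F` of
  pairs of weight `p` (inside `Λ`) and every measurable `A` — fkp-10b's weights-form insertion tolerance
  `FK.rcMeasureW_pow_mul_real_preimage_union_le` (p244352) transported along the lift by `KNFree.tolerance_union_map_liftEdges` (p243920);
* **`del_tolerance_fkLaw`** — `(1-p)^{|F|} · (fkLaw Λ W q){ω | ω ∖ F ∈ A} ≤ (fkLaw Λ W q)(A)` likewise (`…_sdiff_le`);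
* `rcMeasureW_real_mem_eq_zero_of_weight_eq_zero` — a pair of weight `0` is almost surely closed under `rcMeasureW` (`q ≥ 1`);
* **`real_fkLaw_compl_posOnly_eq_zero`** — `hnull`: under `fkLaw Λ W q` almost surely every open pair has nonzero weight
  (`(fkLaw Λ W q)((PosOnly W)ᶜ) = 0`).
So `KNFree.stepII` / `real_manyContacts_diff_Gev_le` / `real_manyContacts_diff_cubeSeeds_le` / `exists_level_real_Gev_gt` apply to every
`fkLaw Λ W q` with `W = p` on the fresh lattice pairs inside the subbox, `1 ≤ q`, `p < 1`.
[cite: Grimmett2006, Thm. (3.1) eq. (3.4) (p. 38); Thm. (3.7) (p. 39); Thm. (4.17)(b) (p. 75)] [cite: KozmaNitzan2024, §4 Lemma 10, Steps II–III (pp. 18–19)]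
-/

noncomputable section

namespace Summit.CriticalPhenomena.PercolationContinuityZ3.Theorems.FK.KNFree

open MeasureTheory Set
open Literature.Probability.Percolation Literature.Probability.LatticeModels
open Literature.Probability.Percolation.KozmaNitzan
open scoped Classical

variable {d : ℕ}

/-! ## Lifted pairs -/

/-- A pair with both endpoints in `Λ` is the lift of a pair of `↥Λ`. [folklore] -/
theorem mem_range_sym2Map_of_forall_mem (Λ : Finset (Site d)) {e : Sym2 (Site d)} (he : ∀ z ∈ e, z ∈ Λ) :
    e ∈ Set.range (Sym2.map (Subtype.val : ↥Λ → Site d)) := by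
  induction e using Sym2.ind with
  | h a b =>
    exact ⟨s(⟨a, he a (Sym2.mem_mk_left a b)⟩, ⟨b, he b (Sym2.mem_mk_right a b)⟩), by simp⟩

/-- Under `FinSupp W Λ` a pair of nonzero weight has both endpoints in `Λ`. [cite: KozmaNitzan2024, Conjecture 1 (p. 3) (finite graphs)] -/
theorem forall_mem_of_finSupp {W : Sym2 (Site d) → unitInterval} {Λ : Finset (Site d)} (hW : FinSupp W Λ) {e : Sym2 (Site d)}
    (he : W e ≠ 0) : ∀ z ∈ e, z ∈ Λ := by
  by_contra h
  push Not at h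
  obtain ⟨z, hz, hzΛ⟩ := h
  exact he (hW.zero e ⟨z, hz, hzΛ⟩)

/-- A finite set of pairs inside `Λ` on which `W` takes the value `p` lies in the lift of the finite set of pairs of `↥Λ` of weight `p`.
[folklore] -/
theorem subset_image_filter_of_weight_eq (Λ : Finset (Site d)) (W : Sym2 (Site d) → unitInterval) {p : unitInterval}
    {F : Finset (Sym2 (Site d))} (hF : ∀ e ∈ F, W e = p) (hFΛ : ∀ e ∈ F, ∀ z ∈ e, z ∈ Λ) :
    F ⊆ (Finset.univ.filter fun e' : Sym2 ↥Λ => W (Sym2.map Subtype.val e') = p).image (Sym2.map Subtype.val) := by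
  intro e he
  obtain ⟨e', rfl⟩ := mem_range_sym2Map_of_forall_mem Λ (hFΛ e he)
  exact Finset.mem_image.2 ⟨e', Finset.mem_filter.2 ⟨Finset.mem_univ _, hF _ he⟩, rfl⟩

/-! ## Insertion and deletion tolerance of `fkLaw` -/

/-- **Insertion tolerance of the law of record** `fkLaw Λ W q` (`q ≥ 1`): for every finite set `F` of pairs inside `Λ` of weight `p` and
every measurable `A`, `(p/(p+q(1-p)))^{|F|} · (fkLaw Λ W q){ω | ω ∪ F ∈ A} ≤ (fkLaw Λ W q)(A)` — the hypothesis `hins` of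
`KNFree.real_manyContacts_diff_Gev_le` / `…_cubeSeeds_le`. [cite: Grimmett2006, Thm. (3.1) eq. (3.4) (p. 38); Thm. (4.17)(b) (p. 75)] -/
theorem ins_tolerance_fkLaw {q : ℝ} (hq : 1 ≤ q) (Λ : Finset (Site d)) (W : Sym2 (Site d) → unitInterval) {p : unitInterval}
    {F : Finset (Sym2 (Site d))} (hF : ∀ e ∈ F, W e = p) (hFΛ : ∀ e ∈ F, ∀ z ∈ e, z ∈ Λ)
    {A : Set (BondConfig (Site d))} (hA : MeasurableSet A) :
    ((p : ℝ) / (p + q * (1 - p))) ^ F.card * (fkLaw Λ W q).real ((fun ω => ω ∪ ↑F) ⁻¹' A) ≤ (fkLaw Λ W q).real A := by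
  unfold fkLaw
  refine tolerance_union_map_liftEdges Λ _ (Finset.univ.filter fun e' : Sym2 ↥Λ => W (Sym2.map Subtype.val e') = p)
    (fun F' A' hF' => FK.rcMeasureW_pow_mul_real_preimage_union_le (fun e' : Sym2 ↥Λ => W (Sym2.map Subtype.val e')) hq ∅
      (fun e' he' => ?_) A') (subset_image_filter_of_weight_eq Λ W hF hFΛ) hA
  have h := (Finset.mem_filter.1 (hF' he')).2
  simp only [h]

/-- **Deletion tolerance of the law of record** `fkLaw Λ W q` (`q ≥ 1`): `(1-p)^{|F|} · (fkLaw Λ W q){ω | ω ∖ F ∈ A} ≤ (fkLaw Λ W q)(A)` for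
every finite set `F` of pairs inside `Λ` of weight `p` and every measurable `A` — the hypothesis `hdel` of `KNFree.stepII`.
[cite: Grimmett2006, Thm. (3.1) eq. (3.4) (p. 38); Thm. (4.17)(b) (p. 75)] -/
theorem del_tolerance_fkLaw {q : ℝ} (hq : 1 ≤ q) (Λ : Finset (Site d)) (W : Sym2 (Site d) → unitInterval) {p : unitInterval}
    {F : Finset (Sym2 (Site d))} (hF : ∀ e ∈ F, W e = p) (hFΛ : ∀ e ∈ F, ∀ z ∈ e, z ∈ Λ)
    {A : Set (BondConfig (Site d))} (hA : MeasurableSet A) :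
    (1 - (p : ℝ)) ^ F.card * (fkLaw Λ W q).real ((fun ω => ω \ ↑F) ⁻¹' A) ≤ (fkLaw Λ W q).real A := by
  unfold fkLaw
  refine tolerance_sdiff_map_liftEdges Λ _ (Finset.univ.filter fun e' : Sym2 ↥Λ => W (Sym2.map Subtype.val e') = p)
    (fun F' A' hF' => FK.rcMeasureW_pow_mul_real_preimage_sdiff_le (fun e' : Sym2 ↥Λ => W (Sym2.map Subtype.val e')) hq ∅
      (fun e' he' => ?_) A') (subset_image_filter_of_weight_eq Λ W hF hFΛ) hA
  have h := (Finset.mem_filter.1 (hF' he')).2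
  simp only [h]

/-! ## Pairs of weight zero are almost surely closed -/

/-- **A pair of weight `0` is almost surely closed** under `rcMeasureW w q B`, `q ≥ 1` (deletion tolerance at `w_e = 0`:
`1 · φ{ω ∖ {e} ∈ univ} ≤ φ{e closed}`). [cite: Grimmett2006, Thm. (3.1) eq. (3.4) (p. 38)] -/
theorem rcMeasureW_real_mem_eq_zero_of_weight_eq_zero {V : Type*} [Fintype V] (w : Sym2 V → unitInterval) {q : ℝ} (hq : 1 ≤ q)
    (B : Set V) {e : Sym2 V} (he : w e = 0) : (rcMeasureW w q B).real {ω | e ∈ ω} = 0 := by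
  haveI := isProbabilityMeasure_rcMeasureW w (one_pos.trans_le hq) B
  have h := FK.rcMeasureW_sub_mul_real_preimage_sdiff_le w hq B e Set.univ
  have h1 : (rcMeasureW w q B).real {ω : BondConfig V | ω \ {e} ∈ (Set.univ : Set (BondConfig V))} = 1 := by
    simp only [Set.mem_univ, Set.setOf_true]; exact probReal_univ
  rw [he, h1, Set.univ_inter] at h
  norm_num at h
  have hc : (rcMeasureW w q B).real {ω : BondConfig V | e ∉ ω} = 1 - (rcMeasureW w q B).real {ω | e ∈ ω} := by
    rw [show {ω : BondConfig V | e ∉ ω} = {ω | e ∈ ω}ᶜ from rfl, probReal_compl_eq_one_sub MeasurableSet.of_discrete]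
  linarith [measureReal_nonneg (μ := rcMeasureW w q B) (s := {ω : BondConfig V | e ∈ ω})]

/-- The event "some open pair has weight `0`" is measurable. [folklore] -/
theorem measurableSet_compl_posOnly (W : Sym2 (Site d) → unitInterval) : MeasurableSet (LData.PosOnly W)ᶜ := by
  have h : (LData.PosOnly W)ᶜ = ⋃ e ∈ {e : Sym2 (Site d) | W e = 0}, {ω : BondConfig (Site d) | e ∈ ω} := by
    ext ω
    simp only [LData.PosOnly, mem_compl_iff, mem_setOf_eq, not_forall, not_not, exists_prop, mem_iUnion]
    exact ⟨fun ⟨e, he, hW⟩ => ⟨e, hW, he⟩, fun ⟨e, hW, he⟩ => ⟨e, he, hW⟩⟩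
  rw [h]
  exact MeasurableSet.biUnion (Set.to_countable _) fun e _ => measurableSet_mem e

/-- **`hnull` for the law of record**: under `fkLaw Λ W q` (`q ≥ 1`) almost surely every open pair has nonzero weight — an open pair is a
lifted pair of `↥Λ`, and lifted pairs of weight `0` are almost surely closed. [cite: Grimmett2006, Thm. (3.7) (p. 39); eq. (3.4)] -/
theorem real_fkLaw_compl_posOnly_eq_zero {q : ℝ} (hq : 1 ≤ q) (Λ : Finset (Site d)) (W : Sym2 (Site d) → unitInterval) :
    (fkLaw Λ W q).real (LData.PosOnly W)ᶜ = 0 := by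
  set w' : Sym2 ↥Λ → unitInterval := fun e' => W (Sym2.map Subtype.val e') with hw'
  haveI := isProbabilityMeasure_rcMeasureW w' (one_pos.trans_le hq) (∅ : Set ↥Λ)
  unfold fkLaw
  rw [real_map_liftEdges_apply Λ _ (measurableSet_compl_posOnly W)]
  refine le_antisymm ?_ measureReal_nonneg
  -- the preimage is covered by the finitely many events "e' open", `w' e' = 0`
  have hcov : liftEdges Λ ⁻¹' (LData.PosOnly W)ᶜ ⊆
      ⋃ e' ∈ (Finset.univ.filter fun e' : Sym2 ↥Λ => w' e' = 0), {ω' : BondConfig ↥Λ | e' ∈ ω'} := by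
    intro ω' hω'
    simp only [mem_preimage, LData.PosOnly, mem_compl_iff, mem_setOf_eq, not_forall, not_not, exists_prop] at hω'
    obtain ⟨e, he, hW⟩ := hω'
    obtain ⟨e', he', rfl⟩ := (mem_liftEdges_iff).1 he
    simp only [mem_iUnion, mem_setOf_eq, exists_prop, Finset.mem_filter, Finset.mem_univ, true_and]
    exact ⟨e', hW, he'⟩
  calc (rcMeasureW w' q ∅).real (liftEdges Λ ⁻¹' (LData.PosOnly W)ᶜ)
      ≤ (rcMeasureW w' q ∅).real (⋃ e' ∈ (Finset.univ.filter fun e' : Sym2 ↥Λ => w' e' = 0), {ω' : BondConfig ↥Λ | e' ∈ ω'}) :=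
        measureReal_mono hcov (measure_ne_top _ _)
    _ ≤ ∑ e' ∈ (Finset.univ.filter fun e' : Sym2 ↥Λ => w' e' = 0), (rcMeasureW w' q ∅).real {ω' : BondConfig ↥Λ | e' ∈ ω'} :=
        measureReal_biUnion_finset_le _ _
    _ = 0 := Finset.sum_eq_zero fun e' he' =>
        rcMeasureW_real_mem_eq_zero_of_weight_eq_zero w' hq ∅ (Finset.mem_filter.1 he').2

end Summit.CriticalPhenomena.PercolationContinuityZ3.Theorems.FK.KNFree

end
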